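import Summits.AtomisticToContinuum.FouriersLaw.Theorems.BondHeatUncertaintyBoundedResponseBathHeatHeatReturnB
import HarnessLib

/-!
# BondHeatUncertainty / BoundedResponse — «HeatReturn» §5: the HEAT-RETURN RUNGS beneath 11071 and their ladder
(decomp-a2c lens-1, g111, NODE 111 «CumulativeResponse / HeatReturn»; part 3 of 3 = main — overview, tags and references in part 1 `…HeatReturnA`)

LADDER (every arrow PROVED, `a ≥ 0`): `LateHeatReturnConvex a` (HR∪) ⟹ `LateHeatReturnMonotone a` (HR↑, via evenness) ⟹ `LateHeatReturnFloor a g` (HRᶠ, every grade,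
constant `0`) ⟹ `LateTailFloor a 1 g` (NODE 109) ⟹ [`g ≤ 1`, with (S)] `BoundedResponse` = 11071 (`heatReturnLadder`); and (HR↑_a) ⟸ pointwise energy-monotonicity
of NODE 110's curves past the blind window (`lateHeatReturnMonotone_of_kinKickProfile_mono`) — the heat-return rungs sit BELOW the energy-response rungs.
Every `def … : Prop` here is a ROUTE STATEMENT of this cell (hung, tagged in its docstring: UNDECIDED · INSTRUMENTABLE by KICK-111), not a literature fact.
No `sorry`, no new axioms.
-/

noncomputable section

open MeasureTheory ProbabilityTheory Filter Topology Set Function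
open scoped NNReal ENNReal
open Literature.MathematicalPhysics.KineticTheory.HeatConduction
open Literature.MathematicalPhysics.KineticTheory OscillatorChain
open Literature.Probability.Process
open Summit.AtomisticToContinuum.FouriersLaw.Theorems.OddSectorIrreversibility
  (pinnedChain_stronglyMeasurable_act_uncurry pinnedChain_integral_sq_act_le_of_stronglyMeasurable
    pinnedChain_integrable_transitionKernel_of_abs_le integral_exp_neg_mul_Ioi' integrable_mul_of_integrable_sq)
open Summit.AtomisticToContinuum.FouriersLaw.Theorems.BoundedResponse.ParityFloor
  (kinObs kinAct continuous_kinObs abs_kinObs_le stronglyMeasurable_kinAct abs_kinAct_le kinAct_integrableOn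
    harrisBound_exists weight_facts kinObs_sq_facts)

namespace Summit.AtomisticToContinuum.FouriersLaw.Theorems.BoundedResponse.HeatSpreading

/-! ## §5 The HEAT-RETURN RUNGS beneath 11071 and the ladder -/

/-- **(HR∪_a) `LateHeatReturnConvex a`** — KICK-CONVEXITY OF THE LATE HEAT RETURN: for every Thouless multiple `c > 0`, eventually in `N`, the heat-return
curve `𝔊^{aN, cN²}_N` is (`ν_T`-a.e.) CONVEX in the kick.  ⟹ (HR↑_a).  Tag: UNDECIDED · INSTRUMENTABLE (KICK-111: ℓ-weighted time sums of `ĝ_u(k) − T`)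
· weaker than pointwise kick-convexity of every late `Ḡ_{N,u}` (NODE 110 (ER∪)).  [route statement · this cell; NOT a literature fact] -/
def LateHeatReturnConvex (a : ℝ) : Prop :=
  ∀ ω₂ lam β γ : ℝ, 0 < ω₂ → 0 < lam → 0 < β → 0 < γ → ∀ T : ℝ, 0 < T → ∀ c : ℝ, 0 < c →
    ∃ N₀ : ℕ, ∀ N : ℕ, N₀ ≤ N →
      ∃ R : ℝ → ℝ, ConvexOn ℝ Set.univ R ∧
        heatReturnProfile ω₂ lam β γ T N (a * N) (c * (N : ℝ) ^ 2) =ᵐ[gaussianReal 0 T.toNNReal] R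

/-- **(HR↑_a) `LateHeatReturnMonotone a`** — MONOTONICITY OF THE LATE HEAT RETURN IN THE INJECTED ENERGY: for every `c > 0`, eventually in `N`, the
heat-return curve `𝔊^{aN, cN²}_N(k) = ∫_{(aN,∞)} ℓ(u)(Ḡ_{N,u}(k) − T) du` is (`ν_T`-a.e.) NONDECREASING IN `k²` («a harder kick of the bath particle never
returns LESS late-time-weighted heat to the boundary»).  ⟹ (HRᶠ_{a,g}) at every grade with constant `0` ⟹ `LateTailFloor a 1 g` ⟹ (with (S)) 11071.
WEAKER than NODE 110's (ER↑_a) (`heatReturnProfile_mono_of_kinKickProfile_mono`: echo timing integrated out).  Why it might fail: hard-kick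
saturation — a very hard kick is drained DIRECTLY into the bath (`γp₀²` dissipation) before the chain can store it, so the late return `e_late(k)` need
not be monotone at `|k| ≫ √T` (Gaussian-cheap region: enters only through (HRᶠ)).  Tag: UNDECIDED · INSTRUMENTABLE (KICK-111) · INCOMPARABLE with 11071.
[route statement · this cell; NOT a literature fact] -/
def LateHeatReturnMonotone (a : ℝ) : Prop :=
  ∀ ω₂ lam β γ : ℝ, 0 < ω₂ → 0 < lam → 0 < β → 0 < γ → ∀ T : ℝ, 0 < T → ∀ c : ℝ, 0 < c →
    ∃ N₀ : ℕ, ∀ N : ℕ, N₀ ≤ N →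
      ∃ R : ℝ → ℝ, (∀ k₁ k₂ : ℝ, k₁ ^ 2 ≤ k₂ ^ 2 → R k₁ ≤ R k₂) ∧
        heatReturnProfile ω₂ lam β γ T N (a * N) (c * (N : ℝ) ^ 2) =ᵐ[gaussianReal 0 T.toNNReal] R

/-- **(HRᶠ_{a,g}) `LateHeatReturnFloor a g`** — GRADED CROSSING DEFECT OF THE LATE HEAT RETURN: `𝔇_T(𝔊^{aN,cN²}_N) ≤ C·N^g` eventually.  At the Ohmic
grade `g = 1` (with (S)) ⟹ 11071; the grade measures how much non-monotone (saturating / echoing) heat return the blocker can afford: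
`B^late_N ≥ −γ²𝔇_T(𝔊)`.  Tag: UNDECIDED · INSTRUMENTABLE · for `g ≥ 1` implied by nothing weaker in the tree and implying `LateTailFloor a 1 g`.
[route statement · this cell; NOT a literature fact] -/
def LateHeatReturnFloor (a g : ℝ) : Prop :=
  ∀ ω₂ lam β γ : ℝ, 0 < ω₂ → 0 < lam → 0 < β → 0 < γ → ∀ T : ℝ, 0 < T → ∀ c : ℝ, 0 < c →
    ∃ C : ℝ, ∃ N₀ : ℕ, ∀ N : ℕ, N₀ ≤ N →
      thermalCrossDefect T (heatReturnProfile ω₂ lam β γ T N (a * N) (c * (N : ℝ) ^ 2)) ≤ C * (N : ℝ) ^ g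

/-- ★ **(HR∪_a) ⟹ (HR↑_a)** (evenness of `𝔊`, symmetrisation). [this cell] -/
theorem lateHeatReturnMonotone_of_convex {a : ℝ} (h : LateHeatReturnConvex a) : LateHeatReturnMonotone a := by
  intro ω₂ lam β γ hω hl hβ hγ T hT c hc
  obtain ⟨N₀, hN₀⟩ := h ω₂ lam β γ hω hl hβ hγ T hT c hc
  refine ⟨N₀, fun N hN => ?_⟩
  obtain ⟨R, hconv, hae⟩ := hN₀ N hN
  exact ⟨fun k => (R k + R (-k)) / 2, monotoneSq_symm_of_convexOn hconv,
    heatReturnProfile_ae_eq_symm hω hl.le hβ.le hγ.le N _ _ hae⟩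

/-- ★ **(HR↑_a) ⟹ (HRᶠ_{a,g}) for every grade `g`** (defect identically `0`; `a ≥ 0`). [this cell] -/
theorem lateHeatReturnFloor_of_monotone {a : ℝ} (ha : 0 ≤ a) (h : LateHeatReturnMonotone a) (g : ℝ) : LateHeatReturnFloor a g := by
  intro ω₂ lam β γ hω hl hβ hγ T hT c hc
  obtain ⟨N₀, hN₀⟩ := h ω₂ lam β γ hω hl hβ hγ T hT c hc
  refine ⟨0, N₀ + 1, fun N hN => ?_⟩
  obtain ⟨n, rfl⟩ : ∃ n, N = n + 1 := ⟨N - 1, by omega⟩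
  obtain ⟨R, hmono, hae⟩ := hN₀ (n + 1) (by omega)
  have hs : 0 ≤ a * ((n + 1 : ℕ) : ℝ) := by positivity
  have ht : 0 ≤ c * ((n + 1 : ℕ) : ℝ) ^ 2 := by positivity
  have hI := (bathTailLate_eq_integral_heatReturnProfile hω hl hβ hγ hT n hs ht).1
  rw [thermalCrossDefect_eq_zero_of_ae_monotoneSq hT.le hI hmono hae]
  simp

/-- ★ **Grade monotonicity**: (HRᶠ_{a,g}) ⟹ (HRᶠ_{a,g'}) for `g ≤ g'`. [formal bookkeeping] -/
theorem lateHeatReturnFloor_mono {a g g' : ℝ} (hgg' : g ≤ g') (h : LateHeatReturnFloor a g) : LateHeatReturnFloor a g' := by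
  intro ω₂ lam β γ hω hl hβ hγ T hT c hc
  obtain ⟨C, N₀, hC⟩ := h ω₂ lam β γ hω hl hβ hγ T hT c hc
  refine ⟨|C|, N₀ + 1, fun N hN => (hC N (by omega)).trans ?_⟩
  have hN1 : (1 : ℝ) ≤ N := by exact_mod_cast (show 1 ≤ N by omega)
  calc C * (N : ℝ) ^ g ≤ |C| * (N : ℝ) ^ g := mul_le_mul_of_nonneg_right (le_abs_self C) (Real.rpow_nonneg (Nat.cast_nonneg N) g)
    _ ≤ |C| * (N : ℝ) ^ g' := mul_le_mul_of_nonneg_left (Real.rpow_le_rpow_of_exponent_le hN1 hgg') (abs_nonneg C)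

/-- ★★ **(HRᶠ_{a,g}) ⟹ `LateTailFloor a 1 g`** (`a ≥ 0`): the heat-return door at route level. [this cell] -/
theorem lateTailFloor_of_lateHeatReturnFloor {a g : ℝ} (ha : 0 ≤ a) (h : LateHeatReturnFloor a g) : LateTailFloor a 1 g := by
  intro ω₂ lam β γ hω hl hβ hγ T hT c hc
  obtain ⟨C, N₀, hC⟩ := h ω₂ lam β γ hω hl hβ hγ T hT c hc
  refine ⟨γ ^ 2 * C, N₀ + 1, fun N hN => ?_⟩
  obtain ⟨n, rfl⟩ : ∃ n, N = n + 1 := ⟨N - 1, by omega⟩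
  have hs : 0 ≤ a * ((n + 1 : ℕ) : ℝ) := by positivity
  have ht : 0 ≤ c * ((n + 1 : ℕ) : ℝ) ^ 2 := by positivity
  have hdoor := bathTailLate_ge_neg_heatReturnDefect hω hl hβ hγ hT n hs ht
  rw [Real.rpow_one]
  refine le_trans ?_ hdoor
  rw [neg_le_neg_iff, mul_assoc]
  exact mul_le_mul_of_nonneg_left (hC (n + 1) (by omega)) (sq_nonneg γ)

open Summit.AtomisticToContinuum.FouriersLaw.Theses.BondHeatUncertainty (BoundedResponse SubdiffusiveBondHeat)

/-- ★★ **(S) ∧ (HRᶠ_{a,g}) ⟹ 11071 for `g ≤ 1`** (through `LateTailFloor a 1 1` and NODE 109's equivalence with the door of record). [this cell] -/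
theorem boundedResponse_of_subdiffusiveBondHeat_lateHeatReturnFloor {a g : ℝ} (ha : 0 ≤ a) (hg : g ≤ 1)
    (hS : SubdiffusiveBondHeat) (h : LateHeatReturnFloor a g) : BoundedResponse :=
  boundedResponse_of_subdiffusiveBondHeat_lateTailFloor ha le_rfl hS
    (lateTailFloor_of_lateHeatReturnFloor ha (lateHeatReturnFloor_mono hg h))

/-- ★★ **(S) ∧ (HR↑_a) ⟹ 11071**: monotonicity of the late cumulative heat return in the injected energy closes the blocker given (S). [this cell] -/
theorem boundedResponse_of_subdiffusiveBondHeat_lateHeatReturnMonotone {a : ℝ} (ha : 0 ≤ a) (hS : SubdiffusiveBondHeat)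
    (h : LateHeatReturnMonotone a) : BoundedResponse :=
  boundedResponse_of_subdiffusiveBondHeat_lateHeatReturnFloor ha le_rfl hS (lateHeatReturnFloor_of_monotone ha h 1)

/-- ★★ **(S) ∧ (HR∪_a) ⟹ 11071.** [this cell] -/
theorem boundedResponse_of_subdiffusiveBondHeat_lateHeatReturnConvex {a : ℝ} (ha : 0 ≤ a) (hS : SubdiffusiveBondHeat)
    (h : LateHeatReturnConvex a) : BoundedResponse :=
  boundedResponse_of_subdiffusiveBondHeat_lateHeatReturnMonotone ha hS (lateHeatReturnMonotone_of_convex h)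

/-- ★ **(HR↑_a) ⟸ pointwise (ER↑) past the blind window**: if eventually in `N` every energy response curve `Ḡ_{N,u}`, `u > aN`, is nondecreasing in
the injected energy (genuinely, not only a.e.), then (HR↑_a) holds (for `N ≥ 2a/c` the window satisfies `2aN ≤ cN²`). [this cell] -/
theorem lateHeatReturnMonotone_of_kinKickProfile_mono {a : ℝ} (ha : 0 ≤ a)
    (h : ∀ ω₂ lam β γ : ℝ, 0 < ω₂ → 0 < lam → 0 < β → 0 < γ → ∀ T : ℝ, 0 < T →
      ∃ N₀ : ℕ, ∀ N : ℕ, N₀ ≤ N → ∀ u : ℝ, a * N < u → ∀ k₁ k₂ : ℝ, k₁ ^ 2 ≤ k₂ ^ 2 →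
        kinKickProfile ω₂ lam β γ T N u k₁ ≤ kinKickProfile ω₂ lam β γ T N u k₂) :
    LateHeatReturnMonotone a := by
  intro ω₂ lam β γ hω hl hβ hγ T hT c hc
  obtain ⟨N₀, hN₀⟩ := h ω₂ lam β γ hω hl hβ hγ T hT
  refine ⟨N₀ + ⌈2 * a / c⌉₊ + 1, fun N hN => ⟨_, fun k₁ k₂ hk => ?_, Eventually.of_forall fun k => rfl⟩⟩
  obtain ⟨n, rfl⟩ : ∃ n, N = n + 1 := ⟨N - 1, by omega⟩
  have hs : 0 ≤ a * ((n + 1 : ℕ) : ℝ) := by positivity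
  have hNc : 2 * a / c ≤ ((n + 1 : ℕ) : ℝ) :=
    (Nat.le_ceil _).trans (by exact_mod_cast (show ⌈2 * a / c⌉₊ ≤ n + 1 by omega))
  have hst : 2 * (a * ((n + 1 : ℕ) : ℝ)) ≤ c * ((n + 1 : ℕ) : ℝ) ^ 2 := by
    have hN0 : (0 : ℝ) ≤ ((n + 1 : ℕ) : ℝ) := by positivity
    have h2 : 2 * a ≤ ((n + 1 : ℕ) : ℝ) * c := by rwa [div_le_iff₀ hc] at hNc
    nlinarith
  exact heatReturnProfile_mono_of_kinKickProfile_mono hω hl hβ hγ hT n hs hst (fun u hu => hN₀ (n + 1) (by omega) u hu) k₁ k₂ hk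

/-- **LADDER OF NODE 111** (every arrow PROVED; `a ≥ 0`): kick-convexity of the heat return ⟹ monotonicity ⟹ graded defect floor (every grade,
constant `0`) ⟹ `LateTailFloor a 1 g` ⟹ (grade `≤ 1`, with (S)) the blocker 11071; and the comparison (HR↑) ⟸ pointwise (ER↑) past the blind window.
[this cell] -/
theorem heatReturnLadder {a : ℝ} (ha : 0 ≤ a) :
    (LateHeatReturnConvex a → LateHeatReturnMonotone a) ∧
    (∀ g : ℝ, LateHeatReturnMonotone a → LateHeatReturnFloor a g) ∧
    (∀ g g' : ℝ, g ≤ g' → LateHeatReturnFloor a g → LateHeatReturnFloor a g') ∧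
    (∀ g : ℝ, LateHeatReturnFloor a g → LateTailFloor a 1 g) ∧
    (∀ g : ℝ, g ≤ 1 → SubdiffusiveBondHeat → LateHeatReturnFloor a g → BoundedResponse) ∧
    (SubdiffusiveBondHeat → LateHeatReturnMonotone a → BoundedResponse) :=
  ⟨lateHeatReturnMonotone_of_convex, fun g h => lateHeatReturnFloor_of_monotone ha h g,
   fun _ _ hgg' h => lateHeatReturnFloor_mono hgg' h, fun _ h => lateTailFloor_of_lateHeatReturnFloor ha h,
   fun _ hg hS h => boundedResponse_of_subdiffusiveBondHeat_lateHeatReturnFloor ha hg hS h,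
   fun hS h => boundedResponse_of_subdiffusiveBondHeat_lateHeatReturnMonotone ha hS h⟩

end Summit.AtomisticToContinuum.FouriersLaw.Theorems.BoundedResponse.HeatSpreading

end
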